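import Summits.SmoothPoincare4.SmoothPoincare4.Theses.SymplecticCap
import Literature.Geometry.Symplectic.JSphereLocalFoliationFromTransverseFamily

/-!
# Birth skeleton — split piece X₂ `LocalFoliationEmbeddedSpheres` (stmt-SmoothPoincare4-16778)

BC3 skeleton for the second piece of the typed split of crux `GromovRecognitionRelEnd`
(stmt-SmoothPoincare4-11009, route SymplecticCap). The piece is the Hofer–Lizan–Sikorav /
Wendl 2018 Prop. 2.53 (`m = 0`) local-foliation fact in two-chart form (= the Literature named
fact `Literature.Geometry.Symplectic.hls_localFoliation_embeddedSphere_trivialNormal`, verbatim).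

PLAN. The fact seats have LANDED, sorry-free, everything in the fact that is differential
topology or intersection theory: the uniqueness clause
(`hls_uniqueness_of_localFamily'`, positivity of intersections + the leaf function + the
homological index + `c₁ = 2 ≠ 0`), openness of the swept set (`isOpen_sweep`), embeddedness and
disjointness of nearby leaves from an immersive evaluation map (`exists_uniform_injective`,
`exists_uniform_injective_mfderiv`), assembled as
`Literature.Geometry.Symplectic.hls_localFoliation_embeddedSphere_trivialNormal_of_transverseFamily`
(JSphereLocalFoliationFromTransverseFamily.lean): the fact follows from ONE analytic core
`hcore` — the existence of a smooth 2-parameter family of `J`-holomorphic two-chart spheres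
through `S = (u₀, v₀)` whose evaluation map is an immersion along the central leaf (Wendl 2018
pp. 65–66: automatic transversality Thm. 2.46 + implicit function theorem Thm. 2.11, and
`ker D_u^N` consists of nowhere-vanishing sections). This skeleton splits `hcore` into its three
genuinely different ingredients, written with the NORMAL VELOCITY of a family in direction
`c ∈ ℂ ≅ ℝ²`, read through the submersion `πN` that trivialises the normal bundle of `S`
(`σ_c(z) = d/da|₀ πN (U a z) · c`, i.e. `(fderiv ℝ (fun a => πN (U a z)) 0) c`, and the same in
the `v`-chart):

* `stub_deformationFamily` (XL — nonlinear Fredholm theory: Wendl 2018 Thm. 2.46 surjectivity of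
  `D_u^N` by automatic transversality since `c₁(N_u) = 0 > 2g − 2`, Thm. 2.11 implicit function
  theorem, index `χ(S²) + 2c₁(N) = 2`): there is a jointly smooth family `(U a, V a)_{‖a‖<ε}` of
  `J`-holomorphic two-chart spheres through `(u₀, v₀)` which is EFFECTIVE at the linearised
  normal level — for every direction `c ≠ 0` the normal velocity section `σ_c` is not identically
  zero on the sphere (the differential of the family onto `ker D_u^N ≅ ℝ²` is an isomorphism).
* `stub_normalVelocityDichotomy` (L — the similarity principle / positivity of zeros for
  real-linear Cauchy–Riemann type operators on a line bundle, Wendl 2018 §2.4–2.5, plus the zero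
  count `Z(σ) = c₁(N) = 0` on the closed sphere): for EVERY smooth `J`-holomorphic family through
  `(u₀, v₀)` and every direction `c`, the normal velocity `σ_c` either vanishes identically or
  vanishes nowhere (both charts).
* `stub_immersionCriterion` (M — manifold calculus: chain rule through `πN`, `πN ∘ u₀ ≡ 0`,
  `ker dπN = TS` along `S`, `u₀` immersed, `v₀` immersed at `0`): if all normal velocity maps
  `c ↦ σ_c(z)` are injective then the evaluation maps `(a, z) ↦ U a z`, `(a, w) ↦ V a w` are
  immersions along `a = 0` — the two clauses of `hcore`.

`LocalFoliationEmbeddedSpheres_of` concludes the piece BY NAME from the three stubs BY NAME (linear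
algebra: effective + dichotomy ⇒ pointwise injective, then the landed reduction); sorries: exactly
the three stubs. No stub is the
piece reworded: the first is an existence statement with a non-degeneracy clause, the second a
property of ALL families, the third pure calculus; none mentions foliations, disjointness or
uniqueness (all landed).
-/

namespace Summit.SmoothPoincare4.SmoothPoincare4.Cruxes.LocalFoliationEmbeddedSpheres.Birth

open scoped Manifold ContDiff Topology
open Set Function Literature.Topology.FourManifolds Literature.Topology.FourManifolds.ComplexProjectiveSpace
open Literature.Geometry.Symplectic

/-- **Stub A — effective deformation family (XL; Wendl 2018 Thm. 2.46 + Thm. 2.11, index 2).**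
Through an embedded `J`-holomorphic two-chart sphere with trivial normal bundle passes a jointly
smooth complex-one-parameter family of `J`-holomorphic two-chart spheres whose normal velocity in
every real direction `c ≠ 0` is not identically zero. -/
theorem stub_deformationFamily :
    ∀ (X : Type) [TopologicalSpace X] [T2Space X] [SecondCountableTopology X]
      [ChartedSpace (EuclideanSpace ℝ (Fin 4)) X] [IsManifold (𝓡 4) ∞ X]
      (JX : AlmostComplexStructure (𝓡 4) ∞ X) (u₀ v₀ : ℂ → X) (N : Set X) (πN : X → ℂ),
      ContMDiff 𝓘(ℝ, ℂ) (𝓡 4) ∞ u₀ → ContMDiff 𝓘(ℝ, ℂ) (𝓡 4) ∞ v₀ → (∀ z : ℂ, z ≠ 0 → v₀ z = u₀ z⁻¹) →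
      IsJHolomorphic (𝓡 4) (fun y => JX y) u₀ → IsJHolomorphic (𝓡 4) (fun y => JX y) v₀ →
      Injective u₀ → (∀ z, Injective (mfderiv 𝓘(ℝ, ℂ) (𝓡 4) u₀ z)) →
      Injective (mfderiv 𝓘(ℝ, ℂ) (𝓡 4) v₀ 0) → v₀ 0 ∉ range u₀ →
      IsOpen N → range u₀ ∪ {v₀ 0} ⊆ N → ContMDiffOn (𝓡 4) 𝓘(ℝ, ℂ) ∞ πN N →
      (∀ y ∈ N, Surjective (mfderiv (𝓡 4) 𝓘(ℝ, ℂ) πN y)) →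
      {y | y ∈ N ∧ πN y = 0} = range u₀ ∪ {v₀ 0} →
      ∃ (ε : ℝ) (U V : ℂ → ℂ → X), 0 < ε ∧
        (∀ z, U 0 z = u₀ z) ∧ (∀ w, V 0 w = v₀ w) ∧
        (∀ a : ℂ, ‖a‖ < ε →
          (∀ z : ℂ, z ≠ 0 → V a z = U a z⁻¹) ∧
          IsJHolomorphic (𝓡 4) (fun y => JX y) (U a) ∧ IsJHolomorphic (𝓡 4) (fun y => JX y) (V a)) ∧
        ContMDiffOn 𝓘(ℝ, ℂ × ℂ) (𝓡 4) ∞ (fun q : ℂ × ℂ => U q.1 q.2) (Metric.ball 0 ε ×ˢ univ) ∧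
        ContMDiffOn 𝓘(ℝ, ℂ × ℂ) (𝓡 4) ∞ (fun q : ℂ × ℂ => V q.1 q.2) (Metric.ball 0 ε ×ˢ univ) ∧
        (∀ c : ℂ, c ≠ 0 →
          (∃ z, (fderiv ℝ (fun a : ℂ => πN (U a z)) 0) c ≠ 0) ∨ (∃ w, (fderiv ℝ (fun a : ℂ => πN (V a w)) 0) c ≠ 0)) := by
  sorry

/-- **Stub B — normal velocity dichotomy (L; similarity principle + `c₁(N) = 0`, Wendl 2018
§2.4–2.5 / Prop. 2.47).** For every smooth `J`-holomorphic family through `(u₀, v₀)` the normal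
velocity section in direction `c` (a solution of the normal linearised Cauchy–Riemann equation,
whose zeros are isolated, positive and counted by `c₁(N) = 0`) is identically zero or nowhere
zero. -/
theorem stub_normalVelocityDichotomy :
    ∀ (X : Type) [TopologicalSpace X] [T2Space X] [SecondCountableTopology X]
      [ChartedSpace (EuclideanSpace ℝ (Fin 4)) X] [IsManifold (𝓡 4) ∞ X]
      (JX : AlmostComplexStructure (𝓡 4) ∞ X) (u₀ v₀ : ℂ → X) (N : Set X) (πN : X → ℂ),
      ContMDiff 𝓘(ℝ, ℂ) (𝓡 4) ∞ u₀ → ContMDiff 𝓘(ℝ, ℂ) (𝓡 4) ∞ v₀ → (∀ z : ℂ, z ≠ 0 → v₀ z = u₀ z⁻¹) →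
      IsJHolomorphic (𝓡 4) (fun y => JX y) u₀ → IsJHolomorphic (𝓡 4) (fun y => JX y) v₀ →
      Injective u₀ → (∀ z, Injective (mfderiv 𝓘(ℝ, ℂ) (𝓡 4) u₀ z)) →
      Injective (mfderiv 𝓘(ℝ, ℂ) (𝓡 4) v₀ 0) → v₀ 0 ∉ range u₀ →
      IsOpen N → range u₀ ∪ {v₀ 0} ⊆ N → ContMDiffOn (𝓡 4) 𝓘(ℝ, ℂ) ∞ πN N →
      (∀ y ∈ N, Surjective (mfderiv (𝓡 4) 𝓘(ℝ, ℂ) πN y)) →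
      {y | y ∈ N ∧ πN y = 0} = range u₀ ∪ {v₀ 0} →
      ∀ (ε : ℝ) (U V : ℂ → ℂ → X), 0 < ε →
      (∀ z, U 0 z = u₀ z) → (∀ w, V 0 w = v₀ w) →
      (∀ a : ℂ, ‖a‖ < ε →
          (∀ z : ℂ, z ≠ 0 → V a z = U a z⁻¹) ∧
          IsJHolomorphic (𝓡 4) (fun y => JX y) (U a) ∧ IsJHolomorphic (𝓡 4) (fun y => JX y) (V a)) →
      ContMDiffOn 𝓘(ℝ, ℂ × ℂ) (𝓡 4) ∞ (fun q : ℂ × ℂ => U q.1 q.2) (Metric.ball 0 ε ×ˢ univ) →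
      ContMDiffOn 𝓘(ℝ, ℂ × ℂ) (𝓡 4) ∞ (fun q : ℂ × ℂ => V q.1 q.2) (Metric.ball 0 ε ×ˢ univ) →
      ∀ c : ℂ,
        ((∀ z, (fderiv ℝ (fun a : ℂ => πN (U a z)) 0) c = 0) ∧ (∀ w, (fderiv ℝ (fun a : ℂ => πN (V a w)) 0) c = 0)) ∨
        ((∀ z, (fderiv ℝ (fun a : ℂ => πN (U a z)) 0) c ≠ 0) ∧ (∀ w, (fderiv ℝ (fun a : ℂ => πN (V a w)) 0) c ≠ 0)) := by
  sorry

/-- **Stub C — immersion criterion (M; manifold chain rule).** If every normal velocity map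
`c ↦ σ_c(z)` (and `c ↦ σ'_c(w)` in the second chart) is injective, the evaluation maps of the
family are immersions along the central leaf: `dπN` kills exactly the leaf directions
(`πN ∘ u₀ ≡ 0`, `dπN` onto along `S`), `u₀` is immersed and `v₀` is immersed at `0`. -/
theorem stub_immersionCriterion :
    ∀ (X : Type) [TopologicalSpace X] [T2Space X] [SecondCountableTopology X]
      [ChartedSpace (EuclideanSpace ℝ (Fin 4)) X] [IsManifold (𝓡 4) ∞ X]
      (JX : AlmostComplexStructure (𝓡 4) ∞ X) (u₀ v₀ : ℂ → X) (N : Set X) (πN : X → ℂ),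
      ContMDiff 𝓘(ℝ, ℂ) (𝓡 4) ∞ u₀ → ContMDiff 𝓘(ℝ, ℂ) (𝓡 4) ∞ v₀ → (∀ z : ℂ, z ≠ 0 → v₀ z = u₀ z⁻¹) →
      IsJHolomorphic (𝓡 4) (fun y => JX y) u₀ → IsJHolomorphic (𝓡 4) (fun y => JX y) v₀ →
      Injective u₀ → (∀ z, Injective (mfderiv 𝓘(ℝ, ℂ) (𝓡 4) u₀ z)) →
      Injective (mfderiv 𝓘(ℝ, ℂ) (𝓡 4) v₀ 0) → v₀ 0 ∉ range u₀ →
      IsOpen N → range u₀ ∪ {v₀ 0} ⊆ N → ContMDiffOn (𝓡 4) 𝓘(ℝ, ℂ) ∞ πN N →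
      (∀ y ∈ N, Surjective (mfderiv (𝓡 4) 𝓘(ℝ, ℂ) πN y)) →
      {y | y ∈ N ∧ πN y = 0} = range u₀ ∪ {v₀ 0} →
      ∀ (ε : ℝ) (U V : ℂ → ℂ → X), 0 < ε →
      (∀ z, U 0 z = u₀ z) → (∀ w, V 0 w = v₀ w) →
      (∀ a : ℂ, ‖a‖ < ε →
          (∀ z : ℂ, z ≠ 0 → V a z = U a z⁻¹) ∧
          IsJHolomorphic (𝓡 4) (fun y => JX y) (U a) ∧ IsJHolomorphic (𝓡 4) (fun y => JX y) (V a)) →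
      ContMDiffOn 𝓘(ℝ, ℂ × ℂ) (𝓡 4) ∞ (fun q : ℂ × ℂ => U q.1 q.2) (Metric.ball 0 ε ×ˢ univ) →
      ContMDiffOn 𝓘(ℝ, ℂ × ℂ) (𝓡 4) ∞ (fun q : ℂ × ℂ => V q.1 q.2) (Metric.ball 0 ε ×ˢ univ) →
      (∀ z, Injective (fderiv ℝ (fun a : ℂ => πN (U a z)) 0)) → (∀ w, Injective (fderiv ℝ (fun a : ℂ => πN (V a w)) 0)) →
      (∀ z, Injective (mfderiv 𝓘(ℝ, ℂ × ℂ) (𝓡 4) (fun q : ℂ × ℂ => U q.1 q.2) (0, z))) ∧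
        Injective (mfderiv 𝓘(ℝ, ℂ × ℂ) (𝓡 4) (fun q : ℂ × ℂ => V q.1 q.2) (0, 0)) := by
  sorry

/-- **Composition (kernel-checked, no sorry of its own): the piece BY NAME from the three stubs BY
NAME**, through the landed reduction `hls_localFoliation_embeddedSphere_trivialNormal_of_transverseFamily`.
The only mathematics here is linear algebra: an effective family (`stub_deformationFamily`) all of
whose directional normal velocities obey the dichotomy (`stub_normalVelocityDichotomy`) has
pointwise-injective normal velocity maps, so `stub_immersionCriterion` applies. -/
theorem LocalFoliationEmbeddedSpheres_of :
    Summit.SmoothPoincare4.SmoothPoincare4.Theses.SymplecticCap.LocalFoliationEmbeddedSpheres := by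
  refine hls_localFoliation_embeddedSphere_trivialNormal_of_transverseFamily ?_
  intro X _ _ _ _ _ JX u₀ v₀ N πN hu₀ hv₀ huv₀ hJu₀ hJv₀ hinj himm₀ himmv hnot hN hsub hπ hπs hzero
  obtain ⟨ε, U, V, hε, hU0, hV0, hleaf, hUs, hVs, heff⟩ :=
    stub_deformationFamily X JX u₀ v₀ N πN hu₀ hv₀ huv₀ hJu₀ hJv₀ hinj himm₀ himmv hnot hN hsub
      hπ hπs hzero
  have hdich := stub_normalVelocityDichotomy X JX u₀ v₀ N πN hu₀ hv₀ huv₀ hJu₀ hJv₀ hinj himm₀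
    himmv hnot hN hsub hπ hπs hzero ε U V hε hU0 hV0 hleaf hUs hVs
  -- effective + dichotomy ⇒ every directional normal velocity is nowhere zero
  have hnz : ∀ c : ℂ, c ≠ 0 →
      (∀ z, (fderiv ℝ (fun a : ℂ => πN (U a z)) 0) c ≠ 0) ∧ (∀ w, (fderiv ℝ (fun a : ℂ => πN (V a w)) 0) c ≠ 0) := by
    intro c hc
    rcases hdich c with ⟨hzU, hzV⟩ | h
    · rcases heff c hc with ⟨z', hz'⟩ | ⟨w', hw'⟩
      · exact absurd (hzU z') hz'
      · exact absurd (hzV w') hw'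
    · exact h
  have hDU : ∀ z, Injective (fderiv ℝ (fun a : ℂ => πN (U a z)) 0) := by
    intro z
    refine (injective_iff_map_eq_zero _).2 fun c hc0 => ?_
    by_contra hc
    exact (hnz c hc).1 z hc0
  have hDV : ∀ w, Injective (fderiv ℝ (fun a : ℂ => πN (V a w)) 0) := by
    intro w
    refine (injective_iff_map_eq_zero _).2 fun c hc0 => ?_
    by_contra hc
    exact (hnz c hc).2 w hc0
  obtain ⟨himmU, himmV⟩ :=
    stub_immersionCriterion X JX u₀ v₀ N πN hu₀ hv₀ huv₀ hJu₀ hJv₀ hinj himm₀ himmv hnot hN hsub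
      hπ hπs hzero ε U V hε hU0 hV0 hleaf hUs hVs hDU hDV
  exact ⟨ε, U, V, hε, hU0, hV0, hleaf, hUs, hVs, himmU, himmV⟩

/-- The same term closes the Literature named fact (the route decl is this constant). -/
theorem hls_localFoliation_embeddedSphere_trivialNormal_of_birth :
    hls_localFoliation_embeddedSphere_trivialNormal :=
  LocalFoliationEmbeddedSpheres_of

end Summit.SmoothPoincare4.SmoothPoincare4.Cruxes.LocalFoliationEmbeddedSpheres.Birth
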